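import Summits.Parity.GeneralizedHardyLittlewood.Theorems.ChenParityOracleBLAPHostParityFromBrickPrimeHostBounds
import Summits.Parity.GeneralizedHardyLittlewood.Theorems.ChenParityOracleBLAPHostParityFromBrickPrimeHostStatic
import HarnessLib

/-!
# Route `ChenParityOracleBLAP` — crux S1 = `HostParityFromBrick` (stmt-Parity-20045): the prime host level sums at all heights

Support file for the prime half `K1 → K2 → HP1` of S1 (step (F2)).  `HTII_of_K` packages the
hyperbolic Type-II bound (`typeII_hyperbolic_static` with `ρ = 1 + (log x)^{−34}`, `A = 90`,
`typeII_rhs_le_uniform`) into the hypothesis `HTII` of `level_vonMangoldt_static` with the uniform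
constant `X₂*(x)`; `level_sum_le_all_heights` bounds `∑_{d ≤ D} |∑_{k ≤ y} Λ(k)[d ∣ k+2]λ(k+2)|`
for every height `y ≤ x` by an explicit `S*(x)` (odd `d` and `y ≥ U²` by `level_vonMangoldt_static`,
odd `d` and `y < U²` trivially, even `d` trivially).

References: H. Iwaniec, E. Kowalski, *Analytic Number Theory* (2004), §13.4, §17.3
[IwaniecKowalski2004].
-/

namespace Summit.Parity.GeneralizedHardyLittlewood.Theorems

open Finset Real
open ArithmeticFunction
open scoped ArithmeticFunction.sigma

/-- **`HTII` from the brick.**  For `x` with `3 ≤ log x`, the K1/K2 bodies at `(δ, 90)` for this `x`,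
`0 < δ ≤ 1/3`, `0 ≤ ε`, `2 < w₀ = exp(log x/log log x)`, a height `y ≤ x` with divisor-moment constant
`C_τ ≥ 0`, and `Dset ⊆ [1, ⌊x^{1/2−ε}⌋]`: every admissible hyperbolic bilinear form is `≤ X₂*(x)`. -/
theorem HTII_of_K {x y : ℕ} (hx : (16 : ℝ) ≤ x) (hL3 : 3 ≤ Real.log x) {δ ε Cτ : ℝ} (hε : 0 ≤ ε)
    (hδ0 : 0 < δ) (hδ : δ ≤ 1 / 3) (hCτ0 : 0 ≤ Cτ)
    (hw : 2 < Real.exp (Real.log x / Real.log (Real.log x)))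
    (hK1 : ∀ M N : ℕ, (x : ℝ) ^ (1 / 3 - δ) ≤ M → (M : ℝ) ≤ (x : ℝ) ^ (1 / 2 : ℝ) →
      (x : ℝ) ^ (1 - δ) ≤ (M : ℝ) * N → (M : ℝ) * N ≤ x → ∀ α β : ℕ → ℝ, (∀ n, |α n| ≤ 1) →
      (∀ n, |β n| ≤ 1) →
      (∀ n, α n ≠ 0 → ∀ p ∈ n.primeFactors, Real.exp (Real.log x / Real.log (Real.log x)) ≤ p) →
      (∀ n, β n ≠ 0 → ∀ p ∈ n.primeFactors, Real.exp (Real.log x / Real.log (Real.log x)) ≤ p) →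
      ∀ h : ℤ, (h = 2 ∨ h = -2) →
      |∑ m ∈ Finset.Ioc M (2 * M), ∑ n ∈ Finset.Ioc N (2 * N),
        α m * β n * (ArithmeticFunction.liouville (Int.toNat ((m : ℤ) * n + h)) : ℝ)| ≤
        (x : ℝ) / Real.log x ^ (90 : ℝ))
    (hK2 : ∀ M N : ℕ, (x : ℝ) ^ (1 / 3 - δ) ≤ M → (M : ℝ) ≤ (x : ℝ) ^ (1 / 2 : ℝ) →
      (x : ℝ) ^ (1 - δ) ≤ (M : ℝ) * N → (M : ℝ) * N ≤ x → ∀ α β : ℕ → ℝ, (∀ n, |α n| ≤ 1) →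
      (∀ n, |β n| ≤ 1) →
      (∀ n, α n ≠ 0 → ∀ p ∈ n.primeFactors, Real.exp (Real.log x / Real.log (Real.log x)) ≤ p) →
      (∀ n, β n ≠ 0 → ∀ p ∈ n.primeFactors, Real.exp (Real.log x / Real.log (Real.log x)) ≤ p) →
      ∀ h : ℤ, (h = 2 ∨ h = -2) →
      (∑ d ∈ (Finset.Icc 1 ⌊(x : ℝ) ^ (1 / 2 - ε)⌋₊).filter (fun d : ℕ => Odd d),
        |(∑ m ∈ Finset.Ioc M (2 * M), ∑ n ∈ (Finset.Ioc N (2 * N)).filter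
            (fun n : ℕ => (d : ℤ) ∣ (m : ℤ) * n + h),
            α m * β n * (ArithmeticFunction.liouville (Int.toNat ((m : ℤ) * n + h)) : ℝ)) -
          (Nat.totient d : ℝ)⁻¹ * ∑ m ∈ Finset.Ioc M (2 * M), ∑ n ∈ Finset.Ioc N (2 * N),
            α m * β n * (ArithmeticFunction.liouville (Int.toNat ((m : ℤ) * n + h)) : ℝ)|) ≤
        (x : ℝ) / Real.log x ^ (90 : ℝ))
    (hyx : y ≤ x)
    (hCτ : ∑ k ∈ Icc 1 y, (σ 0 k : ℝ) * (σ 0 (k + 2) : ℝ) ^ 2 ≤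
      Cτ * ((y : ℝ) + 2) * Real.log ((y : ℝ) + 2) ^ (20 : ℕ))
    {Dset : Finset ℕ} (hD : Dset ⊆ Icc 1 ⌊(x : ℝ) ^ (1 / 2 - ε)⌋₊) :
    ∀ M V₀ : ℕ, (1 + Real.log x ^ (-(34 : ℝ))) * ((x : ℝ) ^ (1 / 3 - δ) + 1) ≤ M →
      2 * (M : ℝ) ≤ (x : ℝ) ^ (2 / 3 : ℝ) →
      ∀ α β : ℕ → ℝ, (∀ n, |α n| ≤ 1) → (∀ n, |β n| ≤ 1) →
      (∀ n, α n ≠ 0 → ∀ p ∈ n.primeFactors, Real.exp (Real.log x / Real.log (Real.log x)) ≤ (p : ℝ)) →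
      (∀ n, β n ≠ 0 → ∀ p ∈ n.primeFactors, Real.exp (Real.log x / Real.log (Real.log x)) ≤ (p : ℝ)) →
      ∑ d ∈ Dset, |∑ m ∈ Ioc M (2 * M), ∑ n ∈ Ioc V₀ (y / m),
        α m * β n * (if d ∣ m * n + 2 then (liouville (m * n + 2) : ℝ) else 0)| ≤
      45 * (x : ℝ) / Real.log x ^ (18 : ℝ) +
        2 ^ (14 : ℕ) * Real.sqrt (Cτ + 1) * ((x : ℝ) / Real.log x ^ (7 : ℝ) +
          (x : ℝ) ^ (1 - δ / 2) * Real.log x ^ (10 : ℝ)) := by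
  intro M V₀ hMlo hMhi α β hα hβ hαs hβs
  have hx1 : 1 ≤ x := by exact_mod_cast (show (1 : ℝ) ≤ x by linarith)
  have hL0 : 0 < Real.log x := by linarith
  have hL1 : 1 ≤ Real.log x := by linarith
  set ρ : ℝ := 1 + Real.log x ^ (-(34 : ℝ)) with hρdef
  have hu0 : 0 < Real.log x ^ (-(34 : ℝ)) := Real.rpow_pos_of_pos hL0 _
  have hρ : 1 < ρ := by rw [hρdef]; linarith
  have hρ2 : ρ ≤ 6 / 5 := by
    -- `L^{-34} ≤ L^{-2} ≤ 1/9`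
    have h1 : Real.log x ^ (-(34 : ℝ)) ≤ Real.log x ^ (-(2 : ℝ)) :=
      Real.rpow_le_rpow_of_exponent_le hL1 (by norm_num)
    have h2 : Real.log x ^ (-(2 : ℝ)) ≤ 1 / 9 := by
      rw [Real.rpow_neg hL0.le, show (2 : ℝ) = ((2 : ℕ) : ℝ) by norm_num, Real.rpow_natCast,
        inv_eq_one_div]
      exact div_le_div_of_nonneg_left zero_le_one (by norm_num) (by nlinarith)
    rw [hρdef]; linarith
  have hM1 : 1 ≤ M := by
    have : (1 : ℝ) ≤ M := le_trans (by
      have : (0 : ℝ) ≤ (x : ℝ) ^ (1 / 3 - δ) := by positivity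
      nlinarith) hMlo
    exact_mod_cast this
  have hstat := typeII_hyperbolic_static (A := 90) hx1 hε hδ hw hK1 hK2 hρ hρ2 hMlo hMhi hyx hα hβ hαs
    hβs (V₀ := V₀) hCτ
  refine le_trans (Finset.sum_le_sum_of_subset_of_nonneg hD fun _ _ _ => abs_nonneg _)
    (hstat.trans ?_)
  have := typeII_rhs_le_uniform (M := M) (y := y) hx hδ0 hδ hCτ0 hM1 hMhi hyx
  simpa only [hρdef] using this

set_option maxHeartbeats 400000 in
/-- **Level sums at all heights.**  For `x` with the structural hypotheses below (all eventually
true), the K1/K2 bodies at `(δ, 90)`, the sifted Type-I bound `HTI` (`X₁ = x/(log x)^{10}`,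
`B = U`), and every height `y ≤ x`:
`∑_{d ≤ D} |∑_{k ≤ y} Λ(k)[d ∣ k+2]λ(k+2)| ≤ S*(x)` with the explicit `S*` of the statement. -/
theorem level_sum_le_all_heights {x U N : ℕ} (hx : (16 : ℝ) ≤ x) (hL3 : 3 ≤ Real.log x)
    {δ ε Cτ : ℝ} (hε : 0 ≤ ε) (hδ0 : 0 < δ) (hδ : δ ≤ 1 / 3) (hCτ0 : 0 ≤ Cτ)
    (hw : 2 < Real.exp (Real.log x / Real.log (Real.log x)))
    (hNw : Real.exp (Real.log x / Real.log (Real.log x)) ≤ N)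
    (hK1 : ∀ M N : ℕ, (x : ℝ) ^ (1 / 3 - δ) ≤ M → (M : ℝ) ≤ (x : ℝ) ^ (1 / 2 : ℝ) →
      (x : ℝ) ^ (1 - δ) ≤ (M : ℝ) * N → (M : ℝ) * N ≤ x → ∀ α β : ℕ → ℝ, (∀ n, |α n| ≤ 1) →
      (∀ n, |β n| ≤ 1) →
      (∀ n, α n ≠ 0 → ∀ p ∈ n.primeFactors, Real.exp (Real.log x / Real.log (Real.log x)) ≤ p) →
      (∀ n, β n ≠ 0 → ∀ p ∈ n.primeFactors, Real.exp (Real.log x / Real.log (Real.log x)) ≤ p) →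
      ∀ h : ℤ, (h = 2 ∨ h = -2) →
      |∑ m ∈ Finset.Ioc M (2 * M), ∑ n ∈ Finset.Ioc N (2 * N),
        α m * β n * (ArithmeticFunction.liouville (Int.toNat ((m : ℤ) * n + h)) : ℝ)| ≤
        (x : ℝ) / Real.log x ^ (90 : ℝ))
    (hK2 : ∀ M N : ℕ, (x : ℝ) ^ (1 / 3 - δ) ≤ M → (M : ℝ) ≤ (x : ℝ) ^ (1 / 2 : ℝ) →
      (x : ℝ) ^ (1 - δ) ≤ (M : ℝ) * N → (M : ℝ) * N ≤ x → ∀ α β : ℕ → ℝ, (∀ n, |α n| ≤ 1) →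
      (∀ n, |β n| ≤ 1) →
      (∀ n, α n ≠ 0 → ∀ p ∈ n.primeFactors, Real.exp (Real.log x / Real.log (Real.log x)) ≤ p) →
      (∀ n, β n ≠ 0 → ∀ p ∈ n.primeFactors, Real.exp (Real.log x / Real.log (Real.log x)) ≤ p) →
      ∀ h : ℤ, (h = 2 ∨ h = -2) →
      (∑ d ∈ (Finset.Icc 1 ⌊(x : ℝ) ^ (1 / 2 - ε)⌋₊).filter (fun d : ℕ => Odd d),
        |(∑ m ∈ Finset.Ioc M (2 * M), ∑ n ∈ (Finset.Ioc N (2 * N)).filter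
            (fun n : ℕ => (d : ℤ) ∣ (m : ℤ) * n + h),
            α m * β n * (ArithmeticFunction.liouville (Int.toNat ((m : ℤ) * n + h)) : ℝ)) -
          (Nat.totient d : ℝ)⁻¹ * ∑ m ∈ Finset.Ioc M (2 * M), ∑ n ∈ Finset.Ioc N (2 * N),
            α m * β n * (ArithmeticFunction.liouville (Int.toNat ((m : ℤ) * n + h)) : ℝ)|) ≤
        (x : ℝ) / Real.log x ^ (90 : ℝ))
    (hCτ : ∀ y : ℕ, ∑ k ∈ Icc 1 y, (σ 0 k : ℝ) * (σ 0 (k + 2) : ℝ) ^ 2 ≤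
      Cτ * ((y : ℝ) + 2) * Real.log ((y : ℝ) + 2) ^ (20 : ℕ))
    (hU : 1 ≤ U)
    (hUlo : (1 + Real.log x ^ (-(34 : ℝ))) * ((x : ℝ) ^ (1 / 3 - δ) + 1) ≤ U)
    (hUhi : 2 * ((U * U : ℕ) : ℝ) ≤ (x : ℝ) ^ (2 / 3 : ℝ))
    (hsq : 2 * ((Nat.sqrt x : ℕ) : ℝ) ≤ (x : ℝ) ^ (2 / 3 : ℝ))
    (HTI : ∀ u : ℕ, u ≤ x → ∀ cb : ℕ → ℝ, (∀ b, |cb b| ≤ 1) →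
      (∀ b, cb b ≠ 0 → Nat.Coprime b (primorial (N - 1))) →
      ∑ d ∈ (Icc 1 ⌊(x : ℝ) ^ (1 / 2 - ε)⌋₊).filter (fun d : ℕ => Odd d), |∑ b ∈ Icc 1 U, cb b *
        ∑ t ∈ (Icc 1 (u / b)).filter (fun t => Nat.Coprime t (primorial (N - 1))),
          (if d ∣ b * t + 2 then (liouville (b * t + 2) : ℝ) else 0)| ≤ (x : ℝ) / Real.log x ^ (10 : ℝ))
    (y : ℕ) (hyx : y ≤ x) :
    ∑ d ∈ Icc 1 ⌊(x : ℝ) ^ (1 / 2 - ε)⌋₊, |∑ k ∈ Icc 1 y, vonMangoldt k *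
        (if d ∣ k + 2 then (liouville (k + 2) : ℝ) else 0)| ≤
      Real.log x * (((x : ℝ) ^ (2 / 3 : ℝ) + 2) * (1 + 2 * Real.log x)) +
      (⌊(x : ℝ) ^ (1 / 2 - ε)⌋₊ : ℝ) * (6 * U + (N : ℝ) * (Nat.log 2 x + 1 : ℕ) * Real.log x) +
      4 * Real.log x * ((x : ℝ) / Real.log x ^ (10 : ℝ)) +
      ((Nat.log 2 (U * U) + 1 : ℕ) : ℝ) * (Real.log x *
        (45 * (x : ℝ) / Real.log x ^ (18 : ℝ) + 2 ^ (14 : ℕ) * Real.sqrt (Cτ + 1) *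
          ((x : ℝ) / Real.log x ^ (7 : ℝ) + (x : ℝ) ^ (1 - δ / 2) * Real.log x ^ (10 : ℝ)))) +
      2 * ((Nat.log 2 x + 1 : ℕ) : ℝ) * (Real.log x ^ 2 *
        (45 * (x : ℝ) / Real.log x ^ (18 : ℝ) + 2 ^ (14 : ℕ) * Real.sqrt (Cτ + 1) *
          ((x : ℝ) / Real.log x ^ (7 : ℝ) + (x : ℝ) ^ (1 - δ / 2) * Real.log x ^ (10 : ℝ)))) +
      (⌊(x : ℝ) ^ (1 / 2 - ε)⌋₊ : ℝ) * ((Nat.log 2 x + 1 : ℕ) : ℝ) := by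
  classical
  have hx0 : (0 : ℝ) < x := by linarith
  have hx1 : (1 : ℝ) ≤ x := by linarith
  have hL0 : 0 < Real.log x := by linarith
  have hX₂0 : 0 ≤ 45 * (x : ℝ) / Real.log x ^ (18 : ℝ) + 2 ^ (14 : ℕ) * Real.sqrt (Cτ + 1) *
      ((x : ℝ) / Real.log x ^ (7 : ℝ) + (x : ℝ) ^ (1 - δ / 2) * Real.log x ^ (10 : ℝ)) := by positivity
  -- odd / even split
  have hsplit : ∑ d ∈ Icc 1 ⌊(x : ℝ) ^ (1 / 2 - ε)⌋₊, |∑ k ∈ Icc 1 y, vonMangoldt k * (if d ∣ k + 2 then (liouville (k + 2) : ℝ) else 0)| =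
      ∑ d ∈ (Icc 1 ⌊(x : ℝ) ^ (1 / 2 - ε)⌋₊).filter (fun d : ℕ => Odd d), |∑ k ∈ Icc 1 y, vonMangoldt k * (if d ∣ k + 2 then (liouville (k + 2) : ℝ) else 0)| +
      ∑ d ∈ (Icc 1 ⌊(x : ℝ) ^ (1 / 2 - ε)⌋₊).filter (fun d : ℕ => Even d), |∑ k ∈ Icc 1 y, vonMangoldt k * (if d ∣ k + 2 then (liouville (k + 2) : ℝ) else 0)| := by
    rw [← Finset.sum_filter_add_sum_filter_not (Icc 1 ⌊(x : ℝ) ^ (1 / 2 - ε)⌋₊) (fun d : ℕ => Odd d)]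
    congr 2
    ext d; simp only [Finset.mem_filter, Nat.not_odd_iff_even]
  have heven : ∑ d ∈ (Icc 1 ⌊(x : ℝ) ^ (1 / 2 - ε)⌋₊).filter (fun d : ℕ => Even d), |∑ k ∈ Icc 1 y, vonMangoldt k * (if d ∣ k + 2 then (liouville (k + 2) : ℝ) else 0)| ≤
      (⌊(x : ℝ) ^ (1 / 2 - ε)⌋₊ : ℝ) * ((Nat.log 2 x + 1 : ℕ) : ℝ) := by
    refine (sum_abs_even_moduli_le ⌊(x : ℝ) ^ (1 / 2 - ε)⌋₊ y).trans (mul_le_mul_of_nonneg_left ?_ (Nat.cast_nonneg _))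
    exact_mod_cast Nat.succ_le_succ (Nat.log_mono_right hyx)
  -- bookkeeping bounds
  have hlogy : Real.log y ≤ (Real.log x) := by
    rcases Nat.eq_zero_or_pos y with rfl | hy
    · simp [hL0.le]
    · exact Real.log_le_log (by exact_mod_cast hy) (by exact_mod_cast hyx)
  have hlogy0 : 0 ≤ Real.log y := Real.log_natCast_nonneg y
  have hlog2x : ((Nat.log 2 y + 1 : ℕ) : ℝ) ≤ ((Nat.log 2 x + 1 : ℕ) : ℝ) := by
    exact_mod_cast Nat.succ_le_succ (Nat.log_mono_right hyx)
  -- odd part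
  have hodd : ∑ d ∈ (Icc 1 ⌊(x : ℝ) ^ (1 / 2 - ε)⌋₊).filter (fun d : ℕ => Odd d), |∑ k ∈ Icc 1 y, vonMangoldt k * (if d ∣ k + 2 then (liouville (k + 2) : ℝ) else 0)| ≤
      (Real.log x) * (((x : ℝ) ^ (2 / 3 : ℝ) + 2) * (1 + 2 * (Real.log x))) +
      (⌊(x : ℝ) ^ (1 / 2 - ε)⌋₊ : ℝ) * (6 * U + (N : ℝ) * (Nat.log 2 x + 1 : ℕ) * (Real.log x)) + 4 * (Real.log x) * ((x : ℝ) / (Real.log x) ^ (10 : ℝ)) +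
      ((Nat.log 2 (U * U) + 1 : ℕ) : ℝ) * ((Real.log x) * (45 * (x : ℝ) / Real.log x ^ (18 : ℝ) + 2 ^ (14 : ℕ) * Real.sqrt (Cτ + 1) *
          ((x : ℝ) / Real.log x ^ (7 : ℝ) + (x : ℝ) ^ (1 - δ / 2) * Real.log x ^ (10 : ℝ)))) + 2 * ((Nat.log 2 x + 1 : ℕ) : ℝ) * ((Real.log x) ^ 2 * (45 * (x : ℝ) / Real.log x ^ (18 : ℝ) + 2 ^ (14 : ℕ) * Real.sqrt (Cτ + 1) *
          ((x : ℝ) / Real.log x ^ (7 : ℝ) + (x : ℝ) ^ (1 - δ / 2) * Real.log x ^ (10 : ℝ)))) := by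
    have hT1 : 0 ≤ (Real.log x) * (((x : ℝ) ^ (2 / 3 : ℝ) + 2) * (1 + 2 * (Real.log x))) := by positivity
    have hT2 : 0 ≤ (⌊(x : ℝ) ^ (1 / 2 - ε)⌋₊ : ℝ) * (6 * U + (N : ℝ) * (Nat.log 2 x + 1 : ℕ) * (Real.log x)) := by positivity
    have hT3 : 0 ≤ 4 * (Real.log x) * ((x : ℝ) / (Real.log x) ^ (10 : ℝ)) := by positivity
    have hT4 : 0 ≤ ((Nat.log 2 (U * U) + 1 : ℕ) : ℝ) * ((Real.log x) * (45 * (x : ℝ) / Real.log x ^ (18 : ℝ) + 2 ^ (14 : ℕ) * Real.sqrt (Cτ + 1) *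
          ((x : ℝ) / Real.log x ^ (7 : ℝ) + (x : ℝ) ^ (1 - δ / 2) * Real.log x ^ (10 : ℝ)))) := by positivity
    have hT5 : 0 ≤ 2 * ((Nat.log 2 x + 1 : ℕ) : ℝ) * ((Real.log x) ^ 2 * (45 * (x : ℝ) / Real.log x ^ (18 : ℝ) + 2 ^ (14 : ℕ) * Real.sqrt (Cτ + 1) *
          ((x : ℝ) / Real.log x ^ (7 : ℝ) + (x : ℝ) ^ (1 - δ / 2) * Real.log x ^ (10 : ℝ)))) := by positivity
    rcases lt_or_ge y (U * U) with hyU | hyU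
    · -- small height: trivial bound
      have h1 : ∑ d ∈ (Icc 1 ⌊(x : ℝ) ^ (1 / 2 - ε)⌋₊).filter (fun d : ℕ => Odd d), |∑ k ∈ Icc 1 y, vonMangoldt k * (if d ∣ k + 2 then (liouville (k + 2) : ℝ) else 0)| ≤
          ∑ d ∈ Icc 1 ⌊(x : ℝ) ^ (1 / 2 - ε)⌋₊, |∑ k ∈ Icc 1 y, vonMangoldt k * (if d ∣ k + 2 then (liouville (k + 2) : ℝ) else 0)| :=
        Finset.sum_le_sum_of_subset_of_nonneg (Finset.filter_subset _ _) fun _ _ _ => abs_nonneg _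
      have h2 := sum_abs_level_trivial_le ⌊(x : ℝ) ^ (1 / 2 - ε)⌋₊ y
      have h3 : Real.log y * (((y + 2 : ℕ) : ℝ) * (1 + Real.log ((y + 2 : ℕ) : ℝ))) ≤
          (Real.log x) * (((x : ℝ) ^ (2 / 3 : ℝ) + 2) * (1 + 2 * (Real.log x))) := by
        have hy2 : ((y + 2 : ℕ) : ℝ) ≤ (x : ℝ) ^ (2 / 3 : ℝ) + 2 := by
          push_cast
          have : (y : ℝ) ≤ ((U * U : ℕ) : ℝ) := by exact_mod_cast hyU.le
          linarith
        have hly2 : Real.log ((y + 2 : ℕ) : ℝ) ≤ 2 * (Real.log x) := by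
          have : ((y + 2 : ℕ) : ℝ) ≤ (x : ℝ) ^ 2 := by
            push_cast; have : (y : ℝ) ≤ x := by exact_mod_cast hyx
            nlinarith
          calc Real.log ((y + 2 : ℕ) : ℝ) ≤ Real.log ((x : ℝ) ^ 2) :=
                Real.log_le_log (by positivity) this
            _ = 2 * (Real.log x) := by rw [Real.log_pow]; push_cast; ring
        have hly0 : 0 ≤ Real.log ((y + 2 : ℕ) : ℝ) := Real.log_natCast_nonneg _
        have hA : ((y + 2 : ℕ) : ℝ) * (1 + Real.log ((y + 2 : ℕ) : ℝ)) ≤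
            ((x : ℝ) ^ (2 / 3 : ℝ) + 2) * (1 + 2 * (Real.log x)) :=
          mul_le_mul hy2 (by linarith) (by positivity) (by positivity)
        exact mul_le_mul hlogy hA (by positivity) hL0.le
      refine h1.trans (h2.trans (h3.trans ?_))
      linarith only [hT2, hT3, hT4, hT5]
    · -- large height: Vaughan
      have hShi : 2 * ((max U (Nat.sqrt y) : ℕ) : ℝ) ≤ (x : ℝ) ^ (2 / 3 : ℝ) := by
        rcases le_total U (Nat.sqrt y) with h | h
        · rw [max_eq_right h]
          have : ((Nat.sqrt y : ℕ) : ℝ) ≤ ((Nat.sqrt x : ℕ) : ℝ) := by exact_mod_cast Nat.sqrt_le_sqrt hyx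
          linarith
        · rw [max_eq_left h]
          have : 2 * (U : ℝ) ≤ 2 * ((U * U : ℕ) : ℝ) := by
            have := Nat.le_mul_of_pos_right U hU
            push_cast; nlinarith [show (1 : ℝ) ≤ U by exact_mod_cast hU]
          linarith
      have hD : (Icc 1 ⌊(x : ℝ) ^ (1 / 2 - ε)⌋₊).filter (fun d : ℕ => Odd d) ⊆ Icc 1 ⌊(x : ℝ) ^ (1 / 2 - ε)⌋₊ :=
        Finset.filter_subset _ _
      have HTII := HTII_of_K (y := y) hx hL3 hε hδ0 hδ hCτ0 hw hK1 hK2 hyx (hCτ y) hD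
      have hstat := level_vonMangoldt_static (N := N) hx hyx hU hyU hUlo hUhi hShi hNw
        ((Icc 1 ⌊(x : ℝ) ^ (1 / 2 - ε)⌋₊).filter (fun d : ℕ => Odd d)) hX₂0 HTI HTII
      have hcard : (#((Icc 1 ⌊(x : ℝ) ^ (1 / 2 - ε)⌋₊).filter (fun d : ℕ => Odd d)) : ℝ) ≤
          (⌊(x : ℝ) ^ (1 / 2 - ε)⌋₊ : ℝ) := by
        have h1 : #((Icc 1 ⌊(x : ℝ) ^ (1 / 2 - ε)⌋₊).filter (fun d : ℕ => Odd d)) ≤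
            #(Icc 1 ⌊(x : ℝ) ^ (1 / 2 - ε)⌋₊) := Finset.card_filter_le _ _
        rw [Nat.card_Icc] at h1
        exact_mod_cast h1.trans (by omega)
      have h6 : (#((Icc 1 ⌊(x : ℝ) ^ (1 / 2 - ε)⌋₊).filter (fun d : ℕ => Odd d)) : ℝ) *
          (6 * U + (N : ℝ) * (Nat.log 2 y + 1 : ℕ) * Real.log y) ≤
          (⌊(x : ℝ) ^ (1 / 2 - ε)⌋₊ : ℝ) * (6 * U + (N : ℝ) * (Nat.log 2 x + 1 : ℕ) * (Real.log x)) := by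
        refine mul_le_mul hcard ?_ (by positivity) (Nat.cast_nonneg _)
        have : (N : ℝ) * (Nat.log 2 y + 1 : ℕ) * Real.log y ≤ (N : ℝ) * (Nat.log 2 x + 1 : ℕ) * (Real.log x) :=
          mul_le_mul (mul_le_mul_of_nonneg_left hlog2x (Nat.cast_nonneg _)) hlogy hlogy0 (by positivity)
        linarith
      refine hstat.trans ?_
      linarith only [h6, hT1]
  rw [hsplit]
  exact add_le_add hodd heven

end Summit.Parity.GeneralizedHardyLittlewood.Theorems
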